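import Summits.Ventures.PercRepro.C041PortProblemCaseIVB

/-!
# The port problem of THEOREM R: the sub-problem beyond a unique gate (p6, gen 23)

Setting of `C041PortProblemDefs` (mine-3, C-041.md §3 (v) / §6 (c)).  When the port-free reach `R₀` of the root has
a UNIQUE gate `p*`, every path from the root to a port leaves `R₀` through `p*` and never needs `R₀` again; the
SUB-PROBLEM `P.sub p*` is the same graph with the vertices of `R₀` deleted (`adj a b ∧ a ∉ R₀ ∧ b ∉ R₀`), rooted at
`p*`, with the ports `M.erase p*` and the same flags.  This file has the dictionary between the two problems:

* `exists_gate_of_reach` — a path from the root to a vertex outside `R₀` avoiding `A ⊆ M` passes a gate; with a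
  unique gate `p*` it passes `p*`, and its remainder is a path of the sub-problem (`reach_sub_of_reach`);
* `reach_of_reach_sub` — a path of the sub-problem from `p*` is a path of `P` (prepended by the port-free path to
  the gate, `reach_gate`);
* `reach_iff_reach_sub` — for `A ⊆ M` with `p* ∉ A` and a target outside `R₀`: `Reach_P A c q ↔ Reach_{sub} A p* q`;
* `not_reach_of_mem_A` — with `p* ∈ A` no port is reached from the root avoiding `A`;
* `sub_ports_reachable` — every port of the sub-problem is reached from `p*` in the sub-problem;
* the pattern correspondence `termSub`, `restrict`, and the facts `A₁`, `A₂`, `X₁`, `X₂`, `Adm` transfer.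
-/

namespace PercRepro

namespace PortProblem

namespace Problem

open Finset

variable {V : Type*}

/-- The sub-problem beyond the gate `p`: the graph with `R₀` deleted, rooted at `p`, ports `M.erase p`. -/
def sub [DecidableEq V] (P : Problem V) (p : V) : Problem V where
  adj a b := P.adj a b ∧ a ∉ P.R₀ ∧ b ∉ P.R₀
  symm _ _ h := ⟨P.symm _ _ h.1, h.2.2, h.2.1⟩
  c := p
  M := P.M.erase p
  hc := fun h => (Finset.mem_erase.1 h).1 rfl
  k₁ := P.k₁
  k₂ := P.k₂
  sw := P.sw
  hk q hq := P.hk q (Finset.mem_of_mem_erase hq)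

/-- Monotonicity of the reflexive-transitive closure in the relation. -/
theorem reflTransGen_mono {α : Type*} {r s : α → α → Prop} (hrs : ∀ a b, r a b → s a b) {u v : α}
    (huv : Relation.ReflTransGen r u v) : Relation.ReflTransGen s u v := by
  induction huv with
  | refl => exact Relation.ReflTransGen.refl
  | tail _ hbc ih => exact ih.tail (hrs _ _ hbc)

variable {P : Problem V}

/-- A port is not in the port-free reach. -/
theorem not_mem_R₀_of_mem_M {p : V} (hp : p ∈ P.M) : p ∉ P.R₀ := fun h => not_mem_M_of_mem_R₀ h hp

/-- **Leaving `R₀`**: a path from the root avoiding `A ⊆ M` that ends outside `R₀` passes a gate `g ∉ A`, and from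
`g` on it avoids `R₀`. -/
theorem exists_gate_of_reach {A : Set V} {q : V} (h : P.Reach A P.c q) (hq : q ∉ P.R₀) :
    ∃ g, P.IsGate g ∧ g ∉ A ∧
      Relation.ReflTransGen (fun a b => (P.adj a b ∧ a ∉ P.R₀ ∧ b ∉ P.R₀) ∧ b ∉ A) g q := by
  obtain ⟨_, hw⟩ := h
  -- invariant: either still inside `R₀`, or a gate has been passed and the path stays outside `R₀`
  have key : ∀ v, Relation.ReflTransGen (fun a b => P.adj a b ∧ b ∉ A) P.c v →
      v ∈ P.R₀ ∨ ∃ g, P.IsGate g ∧ g ∉ A ∧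
        Relation.ReflTransGen (fun a b => (P.adj a b ∧ a ∉ P.R₀ ∧ b ∉ P.R₀) ∧ b ∉ A) g v := by
    intro v hv
    induction hv with
    | refl => exact Or.inl c_mem_R₀
    | @tail b d _ hbd ih =>
      rcases ih with hb | ⟨g, hg, hgA, hw'⟩
      · by_cases hd : d ∈ P.M
        · -- `d` is a gate, reached from `b ∈ R₀`
          exact Or.inr ⟨d, ⟨hd, b, hb, hbd.1⟩, hbd.2, Relation.ReflTransGen.refl⟩
        · exact Or.inl ⟨hb.1, hb.2.tail ⟨hbd.1, hd⟩⟩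
      · by_cases hdR : d ∈ P.R₀
        · -- back into `R₀`: the path so far is forgotten, we are inside again
          exact Or.inl hdR
        · have hbR : b ∉ P.R₀ := by
            rcases Relation.ReflTransGen.cases_tail hw' with h | ⟨_, _, hlast⟩
            · exact h ▸ not_mem_R₀_of_mem_M hg.mem
            · exact hlast.1.2.2
          exact Or.inr ⟨g, hg, hgA, hw'.tail ⟨⟨hbd.1, hbR, hdR⟩, hbd.2⟩⟩
  rcases key q hw with h | h
  · exact absurd h hq
  · exact h

/-- With a unique gate `p`, a path from the root avoiding `A ⊆ M` to a vertex outside `R₀` is, from `p` on, a path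
of the sub-problem. -/
theorem reach_sub_of_reach [DecidableEq V] {p : V} (hp : p ∈ P.M) (huniq : ∀ g, P.IsGate g → g = p)
    {A : Set V} {q : V} (h : P.Reach A P.c q) (hq : q ∉ P.R₀) :
    (P.sub p).Reach A p q := by
  obtain ⟨g, hg, hgA, hw⟩ := exists_gate_of_reach h hq
  have hgp : g = p := huniq g hg
  subst hgp
  exact ⟨hgA, hw⟩

/-- A path of the sub-problem from the gate `p` is a path of `P` from the root (prepend the port-free path). -/
theorem reach_of_reach_sub [DecidableEq V] {p : V} (hp : P.IsGate p) {A : Set V} (hAM : A ⊆ ↑P.M)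
    {q : V} (h : (P.sub p).Reach A p q) : P.Reach A P.c q := by
  refine (reach_gate hAM hp h.1).trans ⟨h.1, ?_⟩
  exact reflTransGen_mono (fun _ _ hab => ⟨hab.1.1, hab.2⟩) h.2

/-- **The reachability dictionary** across a unique gate `p ∉ A`: for `q ∉ R₀`,
`Reach_P A c q ↔ Reach_{sub} A p q`. -/
theorem reach_iff_reach_sub [DecidableEq V] {p : V} (hp : P.IsGate p) (huniq : ∀ g, P.IsGate g → g = p)
    {A : Set V} (hAM : A ⊆ ↑P.M) {q : V} (hq : q ∉ P.R₀) :
    P.Reach A P.c q ↔ (P.sub p).Reach A p q :=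
  ⟨fun h => reach_sub_of_reach hp.mem huniq h hq, fun h => reach_of_reach_sub hp hAM h⟩

/-- With the unique gate deleted (`p ∈ A`), no vertex outside `R₀` is reached from the root avoiding `A`. -/
theorem not_reach_of_gate_mem {p : V} (huniq : ∀ g, P.IsGate g → g = p) {A : Set V}
    (hpA : p ∈ A) {q : V} (hq : q ∉ P.R₀) : ¬ P.Reach A P.c q := by
  intro h
  obtain ⟨g, hg, hgA, _⟩ := exists_gate_of_reach h hq
  exact hgA (huniq g hg ▸ hpA)

/-- **The sub-problem is connected from its root**: every port of `P.sub p` is reached from `p` — the ports of `P`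
other than `p` lie outside `R₀`. -/
theorem sub_ports_reachable [DecidableEq V] {p : V} (hp : P.IsGate p) (huniq : ∀ g, P.IsGate g → g = p)
    (hconn : ∀ q ∈ P.M, Relation.ReflTransGen P.adj P.c q) :
    ∀ q ∈ (P.sub p).M, Relation.ReflTransGen (P.sub p).adj p q := by
  intro q hq
  have hqM : q ∈ P.M := Finset.mem_of_mem_erase hq
  have hqR : q ∉ P.R₀ := not_mem_R₀_of_mem_M hqM
  have h : P.Reach ∅ P.c q := ⟨(Set.mem_empty_iff_false _).1, reflTransGen_mono
    (fun _ _ hab => ⟨hab, (Set.mem_empty_iff_false _).1⟩) (hconn q hqM)⟩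
  have := reach_sub_of_reach hp.mem huniq h hqR
  exact reflTransGen_mono (fun _ _ hab => hab.1) this.2

end Problem

end PortProblem

end PercRepro
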